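import Summits.QuantumFields.QCD.Theorems.SpectralDefectExtinctionWegnerEstimateCoareaLevelCount
import Summits.QuantumFields.QCD.Theorems.SpectralDefectExtinctionWegnerEstimateCoareaCircleAffine
import Summits.QuantumFields.QCD.Theorems.SpectralDefectExtinctionWegnerEstimateCoareaWeylLipschitz
import Summits.QuantumFields.QCD.Theorems.SpectralDefectExtinctionWegnerEstimateCoareaIndicatrix

/-!
# Bridge lemma M toward stub `coareaWegner` of line `Sketch` (skeleton "ResolventCell", gen 2) for
crux `SpectralDefectExtinction.WegnerEstimate` (item stmt-QuantumFields-8966):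
the AREA BOUND along a one-link circle — `Σ_i ∫₀^{2π} |Λ_i'| φ_ε(Λ_i) dt ≤ 4656 π`, uniformly in the volume

This is step (AREA) of the 1-D route (Lines/Sketch.md §gen 2), assembled from the landed bridges:
along the closed one-link circle `s ↦ H(s) = Γ₅ D_W(W[e ↦ W(e) c(s)], m₀, 1)` of a `2π`-periodic
trigonometric link curve `c`,
* `H(s) = H₀ + cos s H₁ + sin s H₂` (bridge H′), so every sorted eigenvalue `Λ_i` is Lipschitz
  (bridge H, Weyl) — `coareaWegner_oneLinkCircle_eigenvalues₀_lipschitz`;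
* `∫_{[0,2π]} |Λ_i'| φ_ε(Λ_i) ≤ 2 ∫ φ_ε(E) #{s ∈ [0,4π] : Λ_i(s) = E} dE` (bridge J, 1-D area inequality);
* `Σ_i #{s ∈ [0,4π] : Λ_i(s) = E} ≤ 2328` off finitely many `E` (bridge L, from `hzero` and the
  multiplicity bound), and `Σ_i ∫ ≤ ∫ Σ_i` for lower integrals;
* `∫ φ_ε = π` (`coareaWegner_lintegral_window`),
giving `coareaWegner_oneLinkCircle_areaBound`: `Σ_i ∫⁻_{[0,2π]} |Λ_i'(t)| φ_ε(Λ_i(t)) dt ≤ 4656 π`, the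
same for every torus size `L`, exterior, mass `m₀` and `ε > 0`.
-/

noncomputable section

namespace Summit.QuantumFields.QCD.Cruxes.WegnerEstimate.ResolventCell

open MeasureTheory
open scoped Matrix BigOperators ENNReal NNReal
open Literature.MathematicalPhysics.QuantumLattice Literature.MathematicalPhysics.QuantumFieldTheory
  Literature.Probability.LatticeModels
open Matrix
open scoped ComplexOrder

/-- `∫ φ_ε = π`: the Wegner window `φ_ε(E) = ε/(E² + ε²)` has total mass `π` for every `ε > 0`. -/
theorem coareaWegner_lintegral_window {ε : ℝ} (hε : 0 < ε) :
    ∫⁻ E : ℝ, ENNReal.ofReal (ε / (E ^ 2 + ε ^ 2)) = ENNReal.ofReal Real.pi := by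
  have hfun : ∀ E : ℝ, ε / (E ^ 2 + ε ^ 2) = ε⁻¹ * (1 + (E / ε) ^ 2)⁻¹ := by
    intro E
    have hε0 : ε ≠ 0 := hε.ne'
    field_simp
    ring
  have hint : Integrable fun E : ℝ => ε / (E ^ 2 + ε ^ 2) := by
    simp_rw [hfun]
    exact ((integrable_inv_one_add_sq.comp_div hε.ne')).const_mul ε⁻¹
  have hnn : 0 ≤ᵐ[volume] fun E : ℝ => ε / (E ^ 2 + ε ^ 2) :=
    Filter.Eventually.of_forall fun E => by positivity
  rw [← ofReal_integral_eq_lintegral_ofReal hint hnn]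
  congr 1
  simp_rw [hfun]
  rw [integral_const_mul, Measure.integral_comp_div (fun u : ℝ => (1 + u ^ 2)⁻¹) ε,
    integral_univ_inv_one_add_sq, abs_of_pos hε, smul_eq_mul, ← mul_assoc, inv_mul_cancel₀ hε.ne', one_mul]

/-- Lower integrals are superadditive: `Σ_i ∫⁻ f_i ≤ ∫⁻ Σ_i f_i` (no measurability needed). -/
theorem coareaWegner_sum_lintegral_le {α ι : Type*} [MeasurableSpace α] (μ : Measure α) (s : Finset ι)
    (f : ι → α → ℝ≥0∞) : ∑ i ∈ s, ∫⁻ x, f i x ∂μ ≤ ∫⁻ x, ∑ i ∈ s, f i x ∂μ := by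
  classical
  induction s using Finset.induction_on with
  | empty => simp
  | insert a s ha ih =>
    rw [Finset.sum_insert ha]
    calc ∫⁻ x, f a x ∂μ + ∑ i ∈ s, ∫⁻ x, f i x ∂μ ≤ ∫⁻ x, f a x ∂μ + ∫⁻ x, ∑ i ∈ s, f i x ∂μ :=
          add_le_add le_rfl ih
      _ ≤ ∫⁻ x, (f a x + ∑ i ∈ s, f i x) ∂μ := le_lintegral_add _ _
      _ = ∫⁻ x, ∑ i ∈ insert a s, f i x ∂μ := by
          refine lintegral_congr fun x => ?_
          rw [Finset.sum_insert ha]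

/-- **Sorted eigenvalues along a one-link circle are uniformly Lipschitz** (bridge H′ + Weyl). -/
theorem coareaWegner_oneLinkCircle_eigenvalues₀_lipschitz {L : ℕ} [NeZero L] (W : GaugeConfig 4 L SU3)
    (m₀ : ℝ) (z : TorusSite 4 L) (μ : Fin 4) (c : ℝ → SU3) (δ₀ δ₁ δ₂ : Matrix (Fin 3) (Fin 3) ℂ)
    (hc : ∀ t, ((c t : SU3) : Matrix (Fin 3) (Fin 3) ℂ) =
      δ₀ + ((Real.cos t : ℝ) : ℂ) • δ₁ + ((Real.sin t : ℝ) : ℂ) • δ₂)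
    (hH : ∀ s : ℝ, (spinorLift gammaFive * wilsonDirac (fundamentalRep (Fin 3))
      (Function.update W (z, μ) (W (z, μ) * c s)) m₀ 1).IsHermitian) :
    ∃ K : ℝ≥0, ∀ i : Fin (Fintype.card (QuarkIdx L)), LipschitzWith K (fun s => (hH s).eigenvalues₀ i) := by
  obtain ⟨H₀, H₁, H₂, hfam⟩ := coareaWegner_oneLinkCircle_affine W m₀ z μ c δ₀ δ₁ δ₂ hc
  refine ⟨Fintype.card (QuarkIdx L) * ∑ p' : QuarkIdx L, ∑ q' : QuarkIdx L, (‖H₁ p' q'‖₊ + ‖H₂ p' q'‖₊),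
    fun i => coareaWegner_eigenvalues₀_lipschitz _ hH (fun s t p q => ?_) i⟩
  rw [hfam s, hfam t]
  exact coareaWegner_trigFamily_lipschitz_const H₀ H₁ H₂ s t p q

/-- **The area bound along a one-link circle** (step (AREA) of the 1-D route, uniform in `L`).
For a gauge field `W`, a link `e = (z, μ)`, a `2π`-periodic trigonometric link curve `c` in `SU(3)`,
the sorted eigenvalues `Λ_i(s)` of `H(s) = Γ₅ D_W(W[e ↦ W(e) c(s)], m₀, 1)` and every `ε > 0`:
`Σ_i ∫⁻_{[0,2π]} |Λ_i'(t)| · ε/(Λ_i(t)² + ε²) dt ≤ 4656 π`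
(`hzero` = the landed `stub_circleZeroCount`; bridges H, H′, J, L). -/
theorem coareaWegner_oneLinkCircle_areaBound
    (hzero : ∀ (N r : ℕ) (A : Matrix (Fin N) (Fin N) ℂ) (B : Matrix (Fin N) (Fin r) ℂ) (C : Matrix (Fin r) (Fin N) ℂ)
      (δ₀ δ₁ δ₂ : Matrix (Fin r) (Fin r) ℂ),
      (∀ t : ℝ, (A + B * (δ₀ + ((Real.cos t : ℝ) : ℂ) • δ₁ + ((Real.sin t : ℝ) : ℂ) • δ₂) * C).det = 0) ∨
      ({t : ℝ | t ∈ Set.Ico (0 : ℝ) (2 * Real.pi) ∧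
          (A + B * (δ₀ + ((Real.cos t : ℝ) : ℂ) • δ₁ + ((Real.sin t : ℝ) : ℂ) • δ₂) * C).det = 0}.Finite ∧
        {t : ℝ | t ∈ Set.Ico (0 : ℝ) (2 * Real.pi) ∧
          (A + B * (δ₀ + ((Real.cos t : ℝ) : ℂ) • δ₁ + ((Real.sin t : ℝ) : ℂ) • δ₂) * C).det = 0}.ncard ≤ 2 * r))
    {L : ℕ} [NeZero L] (W : GaugeConfig 4 L SU3) (m₀ : ℝ) (z : TorusSite 4 L) (μ : Fin 4) (c : ℝ → SU3)
    (δ₀ δ₁ δ₂ : Matrix (Fin 3) (Fin 3) ℂ)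
    (hc : ∀ t, ((c t : SU3) : Matrix (Fin 3) (Fin 3) ℂ) =
      δ₀ + ((Real.cos t : ℝ) : ℂ) • δ₁ + ((Real.sin t : ℝ) : ℂ) • δ₂)
    (hper : ∀ t, c (t + 2 * Real.pi) = c t)
    (hH : ∀ s : ℝ, (spinorLift gammaFive * wilsonDirac (fundamentalRep (Fin 3))
      (Function.update W (z, μ) (W (z, μ) * c s)) m₀ 1).IsHermitian)
    {ε : ℝ} (hε : 0 < ε) :
    ∑ i : Fin (Fintype.card (QuarkIdx L)), ∫⁻ t in Set.Icc 0 (2 * Real.pi),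
      ENNReal.ofReal (|deriv (fun s => (hH s).eigenvalues₀ i) t| *
        (ε / ((hH t).eigenvalues₀ i ^ 2 + ε ^ 2))) ≤ ENNReal.ofReal (4656 * Real.pi) := by
  set Λ : Fin (Fintype.card (QuarkIdx L)) → ℝ → ℝ := fun i s => (hH s).eigenvalues₀ i with hΛ
  set φ : ℝ → ℝ := fun E => ε / (E ^ 2 + ε ^ 2) with hφ
  have hφc : Continuous φ := by
    refine continuous_const.div (by fun_prop) fun E => ?_
    positivity
  have hφ0 : ∀ E, 0 ≤ φ E := fun E => by positivity
  set Ncount : Fin (Fintype.card (QuarkIdx L)) → ℝ → ℝ≥0∞ := fun i E =>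
    (({s : ℝ | s ∈ Set.Icc 0 (2 * Real.pi + 2 * Real.pi) ∧ Λ i s = E}.encard : ENat) : ENNReal) with hN
  obtain ⟨K, hK⟩ := coareaWegner_oneLinkCircle_eigenvalues₀_lipschitz W m₀ z μ c δ₀ δ₁ δ₂ hc hH
  obtain ⟨F, hFfin, hcount⟩ := coareaWegner_oneLinkCircle_levelCount hzero W m₀ z μ c δ₀ δ₁ δ₂ hc hper hH
  -- each sorted eigenvalue: the 1-D area inequality
  have hJ : ∀ i, ∫⁻ t in Set.Icc 0 (2 * Real.pi), ENNReal.ofReal (|deriv (Λ i) t| * φ (Λ i t)) ≤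
      2 * ∫⁻ E, ENNReal.ofReal (φ E) * Ncount i E := fun i =>
    coareaWegner_lintegral_deriv_mul_le_crossings (hK i) hφc hφ0 Real.two_pi_pos.le Real.two_pi_pos
  -- the summed count, off the finite set `F`
  have hae : ∀ᵐ E : ℝ, ∑ i, ENNReal.ofReal (φ E) * Ncount i E ≤ ENNReal.ofReal (φ E) * 2328 := by
    have hnull : volume F = 0 := hFfin.measure_zero volume
    rw [ae_iff]
    refine measure_mono_null (fun E hE => ?_) hnull
    by_contra hEF
    refine hE ?_
    rw [← Finset.mul_sum]
    exact mul_le_mul' le_rfl (hcount E hEF)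
  calc ∑ i, ∫⁻ t in Set.Icc 0 (2 * Real.pi), ENNReal.ofReal (|deriv (Λ i) t| * φ (Λ i t))
      ≤ ∑ i, 2 * ∫⁻ E, ENNReal.ofReal (φ E) * Ncount i E := Finset.sum_le_sum fun i _ => hJ i
    _ = 2 * ∑ i, ∫⁻ E, ENNReal.ofReal (φ E) * Ncount i E := by rw [Finset.mul_sum]
    _ ≤ 2 * ∫⁻ E, ∑ i, ENNReal.ofReal (φ E) * Ncount i E :=
        mul_le_mul' le_rfl (coareaWegner_sum_lintegral_le _ _ _)
    _ ≤ 2 * ∫⁻ E, ENNReal.ofReal (φ E) * 2328 := mul_le_mul' le_rfl (lintegral_mono_ae hae)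
    _ = 2 * (2328 * ∫⁻ E, ENNReal.ofReal (φ E)) := by
        rw [lintegral_mul_const' _ _ (by norm_num), mul_comm (∫⁻ E, ENNReal.ofReal (φ E)) 2328]
    _ = 2 * (2328 * ENNReal.ofReal Real.pi) := by rw [coareaWegner_lintegral_window hε]
    _ = ENNReal.ofReal (4656 * Real.pi) := by
        rw [← mul_assoc, ENNReal.ofReal_mul (by norm_num)]
        norm_num

end Summit.QuantumFields.QCD.Cruxes.WegnerEstimate.ResolventCell

end
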